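import Summits.ValiantsHypothesis.ValiantsHypothesis.Theorems.PolyaContinuedSignedCoverLittleStubEven
import Summits.ValiantsHypothesis.ValiantsHypothesis.Theorems.PolyaContinuedSignedCoverLittleChain
import Summits.ValiantsHypothesis.ValiantsHypothesis.Theorems.PolyaContinuedSignedCoverLittleNoParallel
import Summits.ValiantsHypothesis.ValiantsHypothesis.Theorems.PolyaContinuedSignedCoverLittleTranspose
import HarnessLib

/-!
# Route PolyaContinued — support item `SignedCoverLittle` (stmt-ValiantsHypothesis-7426):
# the item modulo the fold and the base case

Integration of the port (seats p1–p4 of the 7426 LabelTransfer port): the lead's driver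
`labelIdentity_chain_of` (`…Chain.lean`, four specs `hSB`, `hNP`, `hT`, `hBase`) composed with the
H-side closer `signedCoverLittle_of_chain` (`…StubEven.lean`), with the two specs that have landed
DISCHARGED — `hNP` by `not_parallel_of_deletionMinimal` (`…NoParallel.lean`) and `hT` by
`labelIdentity_transpose'` (`…Transpose.lean`). What remains are the two E-side specs, taken here
as hypotheses quantified over the board size:

* `hSB` — the same-board bicontraction (fold) of a two-cell row without parallel rows;
* `hBase` — a deletion-minimal non-Pfaffian target without two-cell lines is a relabelled
  standard target `K_{3,3} ⊔ diagonal`.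

`signedCoverLittle_of_fold_and_base hSB hBase : SignedCoverLittle`; the closing file of the item
is this theorem applied to the two landed lemmas.
-/

noncomputable section

namespace Summit.ValiantsHypothesis.PolyaContinued

open MvPolynomial Finset Literature.Combinatorics.SimpleGraph Equiv

/-- **`SignedCoverLittle` from the fold and the base case.** The item follows from the two
remaining E-side section lemmas of the chain (specs `hSB`, `hBase` of `labelIdentity_chain_of`,
quantified over the board size `n`); the specs `hNP` and `hT` are discharged by
`not_parallel_of_deletionMinimal` and `labelIdentity_transpose'`, the H-side by
`signedCoverLittle_of_chain`. [folklore] -/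
theorem signedCoverLittle_of_fold_and_base
    (hSB : ∀ (n : ℕ) (E : Finset (Fin n × Fin n)) (a b₀ b₁ : Fin n), b₀ ≠ b₁ →
      (∀ c, (a, c) ∈ E ↔ c = b₀ ∨ c = b₁) →
      (∀ r, r ≠ a → ¬ ((r, b₀) ∈ E ∧ (r, b₁) ∈ E)) →
      ∃ (E₂ : Finset (Fin n × Fin n)) (ψ : Fin n × Fin n → Fin n × Fin n),
        E₂.card < E.card ∧ (IsPfaffianBipartite E₂ ↔ IsPfaffianBipartite E) ∧
        ∀ (H : Finset (Fin n × Fin n)) (φ : Fin n × Fin n → Fin n × Fin n),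
          (∑ σ : Perm (Fin n), if (∀ i, (i, σ i) ∈ H) then
              ∏ i, (X (φ (i, σ i)) : MvPolynomial (Fin n × Fin n) ℂ) else 0) =
            perfectMatchingPoly E ℂ →
          (∑ σ : Perm (Fin n), if (∀ i, (i, σ i) ∈ H) then
              ∏ i, (X (ψ (φ (i, σ i))) : MvPolynomial (Fin n × Fin n) ℂ) else 0) =
            perfectMatchingPoly E₂ ℂ)
    (hBase : ∀ (n : ℕ) (E : Finset (Fin n × Fin n)), ¬ IsPfaffianBipartite E →
      (∀ e ∈ E, IsPfaffianBipartite (E.erase e)) →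
      (∀ i, (E.filter fun c : Fin n × Fin n => c.1 = i).card ≠ 2) →
      (∀ j, (E.filter fun c : Fin n × Fin n => c.2 = j).card ≠ 2) →
      ∃ ρ κ : Perm (Fin n), E = relabel (Finset.univ.filter fun e : Fin n × Fin n =>
        ((e.1 : ℕ) < 3 ∧ (e.2 : ℕ) < 3) ∨ (e.1 = e.2 ∧ 3 ≤ (e.1 : ℕ))) ρ κ) :
    Summit.ValiantsHypothesis.ValiantsHypothesis.Theses.PolyaContinued.SignedCoverLittle :=
  signedCoverLittle_of_chain fun n H E φ hid hE =>
    labelIdentity_chain_of (hSB n)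
      (fun E _ _ _ hE' hdel hb hrow _ hr h =>
        not_parallel_of_deletionMinimal (E := E) hE' hdel hb hrow hr h.1 h.2)
      (fun _ _ _ h => labelIdentity_transpose' h) (hBase n) H E φ hid hE

end Summit.ValiantsHypothesis.PolyaContinued
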